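import Summits.RiemannHypothesis.RiemannHypothesis.Theorems.SoloInformedMarkovIndex

/-!
# RH ⟺ the Markov part of Weil's form has at most one bound state (converse and assembly)

Solo programme `solo-RiemannHypothesis-informed`, session 14; continuation of
`SoloInformedMarkovIndex.lean` (notation as there). Everything here is proved.

* `riemannHypothesis_of_markovIndex_le_one`: if among any two test functions some non-trivial
  combination `v` has `Q₀(v) ≥ 0` (`Q₀ = weilMarkovQuadratic`, the pole-removed = Markov part of
  `Re W(v ⋆ ṽ)`), then RH. Proof: otherwise a pole-free `w` with `Re Q(w) < 0` exists
  (`riemannHypothesis_iff_poleFree`) and, for two far-apart bumps `e_a = u(· − a) + u(· + a)`,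
  `Q₀` is negative definite on `span(w, e_a)` once `a` is large (Tannery over the zeros).
* `riemannHypothesis_iff_markovIndex_le_one`: the equivalence.
* `exists_weilMarkovQuadratic_neg`: `Q₀(e_a) < 0` for large `a`, unconditionally; with the
  forward direction, under RH the negative index of `Q₀` is exactly one on all large windows.

[cite: Bombieri2000Weil, Thms. 1–2]; [cite: Yoshida1992, §6].
-/

noncomputable section

open Complex Filter Set MeasureTheory
open scoped Real Topology ComplexConjugate

namespace Summit.RiemannHypothesis.RiemannHypothesis.Theorems

open Literature.NumberTheory.LFunctions Literature.NumberTheory.LFunctions.WeilConverse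

/-! ## Polarisation of the zero-side form -/

/-- `m P_{αg+βh}(ρ)` expanded into the four sesquilinear pieces. [folklore] -/
theorem mul_pairCoeff_lin {g h : ℝ → ℂ} (hg : IsWeilTest g) (hh : IsWeilTest h)
    (α β m ρ : ℂ) :
    m * pairCoeff (fun t ↦ α * g t + β * h t) ρ =
      α * conj α * (m * pairCoeff g ρ) +
        α * conj β * (m * (weilMellin g ρ * conj (weilMellin h (1 - conj ρ)))) +
        conj α * β * (m * (weilMellin h ρ * conj (weilMellin g (1 - conj ρ)))) +
        β * conj β * (m * pairCoeff h ρ) := by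
  simp only [pairCoeff, weilMellin_lin hg hh, map_add, map_mul]
  ring

/-- **Polarisation**: `Q(αg + βh) = |α|² Q(g) + α β̄ X + ᾱ β Y + |β|² Q(h)` with the cross sums
`X = ∑ m ĝ(ρ) conj ĥ(1−ρ̄)`, `Y = ∑ m ĥ(ρ) conj ĝ(1−ρ̄)` (all four series converge absolutely).
[folklore] -/
theorem zeroForm_lin {g h : ℝ → ℂ} (hg : IsWeilTest g) (hh : IsWeilTest h) (α β : ℂ) :
    zeroForm (fun t ↦ α * g t + β * h t) =
      α * conj α * zeroForm g +
        α * conj β * (∑' ρ : ZetaZeros.riemannZetaNontrivialZeros,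
          (riemannZetaZeroOrder (ρ : ℂ) : ℂ) *
            (weilMellin g ρ * conj (weilMellin h (1 - conj (ρ : ℂ))))) +
        conj α * β * (∑' ρ : ZetaZeros.riemannZetaNontrivialZeros,
          (riemannZetaZeroOrder (ρ : ℂ) : ℂ) *
            (weilMellin h ρ * conj (weilMellin g (1 - conj (ρ : ℂ))))) +
        β * conj β * zeroForm h := by
  have hA := (summable_pairCoeff hg).mul_left (α * conj α)
  have hB := (summable_norm_cross hg hh).of_norm.mul_left (α * conj β)
  have hC := (summable_norm_cross hh hg).of_norm.mul_left (conj α * β)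
  have hD := (summable_pairCoeff hh).mul_left (β * conj β)
  unfold zeroForm
  rw [show (fun ρ : ZetaZeros.riemannZetaNontrivialZeros ↦ (riemannZetaZeroOrder (ρ : ℂ) : ℂ) *
      pairCoeff (fun t ↦ α * g t + β * h t) ρ) = fun ρ : ZetaZeros.riemannZetaNontrivialZeros ↦
      α * conj α * ((riemannZetaZeroOrder (ρ : ℂ) : ℂ) * pairCoeff g ρ) +
        α * conj β * ((riemannZetaZeroOrder (ρ : ℂ) : ℂ) *
          (weilMellin g ρ * conj (weilMellin h (1 - conj (ρ : ℂ))))) +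
        conj α * β * ((riemannZetaZeroOrder (ρ : ℂ) : ℂ) *
          (weilMellin h ρ * conj (weilMellin g (1 - conj (ρ : ℂ))))) +
        β * conj β * ((riemannZetaZeroOrder (ρ : ℂ) : ℂ) * pairCoeff h ρ) from
      funext fun ρ ↦ mul_pairCoeff_lin hg hh α β _ _,
    ((hA.add hB).add hC).tsum_add hD, (hA.add hB).tsum_add hC, hA.tsum_add hB,
    tsum_mul_left, tsum_mul_left, tsum_mul_left, tsum_mul_left]

/-- `Re((α conj β) z) ≤ |α| |β| |z|`. [folklore] -/
theorem re_mul_conj_mul_le (α β z : ℂ) : (α * conj β * z).re ≤ ‖α‖ * ‖β‖ * ‖z‖ := by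
  refine (Complex.re_le_norm _).trans ?_
  rw [norm_mul, norm_mul, Complex.norm_conj]

/-- `Re((α conj α) z) = |α|² Re z`. [folklore] -/
theorem re_mul_conj_self_mul (α z : ℂ) : (α * conj α * z).re = ‖α‖ ^ 2 * z.re := by
  rw [Complex.mul_conj, Complex.normSq_eq_norm_sq, Complex.re_ofReal_mul]

/-! ## The large window -/

/-- For tests `w, u` and `ε, δ > 0` there is a distance `a ≥ 0` at which both cross sums of `w`
against `e_a = u(· − a) + u(· + a)` are `≤ ε e^{a/2}` and `|Q(e_a)| ≤ δ e^{a}` (three applications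
of Tannery's theorem over the zeros). [folklore] -/
theorem exists_far_window {w u : ℝ → ℂ} (hw : IsWeilTest w) (hu : IsWeilTest u) {ε δ : ℝ}
    (hε : 0 < ε) (hδ : 0 < δ) :
    ∃ a : ℝ, 0 ≤ a ∧
      ‖∑' ρ : ZetaZeros.riemannZetaNontrivialZeros, (riemannZetaZeroOrder (ρ : ℂ) : ℂ) *
          (weilMellin w ρ * conj (weilMellin (weilTranslate u a + weilTranslate u (-a))
            (1 - conj (ρ : ℂ))))‖ ≤ ε * Real.exp (a / 2) ∧
      ‖∑' ρ : ZetaZeros.riemannZetaNontrivialZeros, (riemannZetaZeroOrder (ρ : ℂ) : ℂ) *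
          (weilMellin (weilTranslate u a + weilTranslate u (-a)) ρ *
            conj (weilMellin w (1 - conj (ρ : ℂ))))‖ ≤ ε * Real.exp (a / 2) ∧
      ‖zeroForm (weilTranslate u a + weilTranslate u (-a))‖ ≤ δ * Real.exp a := by
  -- the two-bump factor `E a s`
  set E : ℝ → ℂ → ℂ := fun a s ↦ cexp ((s - 1 / 2) * a) + cexp ((s - 1 / 2) * ((-a : ℝ) : ℂ))
    with hE
  have hEb : ∀ a : ℝ, 0 ≤ a → ∀ ρ ∈ ZetaZeros.riemannZetaNontrivialZeros,
      ‖E a ρ‖ ≤ 2 * Real.exp (|ρ.re - 1 / 2| * a) ∧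
        ‖E a (1 - conj ρ)‖ ≤ 2 * Real.exp (|ρ.re - 1 / 2| * a) := by
    intro a ha ρ _
    refine ⟨norm_twoExp_le ρ ha, ?_⟩
    have h := norm_twoExp_le (1 - conj ρ) ha
    rwa [one_sub_conj_re, show |1 - ρ.re - 1 / 2| = |ρ.re - 1 / 2| by
      rw [abs_sub_comm]; ring_nf] at h
  -- Tannery three times
  have TX := tendsto_zeroSum_of_growth (θ := 1 / 2) (M := 2) one_half_pos zero_le_two
    (c := fun s ↦ weilMellin w s * conj (weilMellin u (1 - conj s)))
    (Φ := fun a s ↦ conj (E a (1 - conj s))) (summable_norm_cross hw hu) fun a ha ρ hρ ↦ by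
      rw [Complex.norm_conj, show 2 * (1 / 2 : ℝ) * |ρ.re - 1 / 2| * a = |ρ.re - 1 / 2| * a by
        ring]
      exact (hEb a ha ρ hρ).2
  have TY := tendsto_zeroSum_of_growth (θ := 1 / 2) (M := 2) one_half_pos zero_le_two
    (c := fun s ↦ weilMellin u s * conj (weilMellin w (1 - conj s)))
    (Φ := fun a s ↦ E a s) (summable_norm_cross hu hw) fun a ha ρ hρ ↦ by
      rw [show 2 * (1 / 2 : ℝ) * |ρ.re - 1 / 2| * a = |ρ.re - 1 / 2| * a by ring]
      exact (hEb a ha ρ hρ).1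
  have TE := tendsto_zeroSum_of_growth (θ := 1) (M := 4) one_pos (by norm_num)
    (c := fun s ↦ pairCoeff u s) (Φ := fun a s ↦ E a s * conj (E a (1 - conj s)))
    (summable_norm_pairCoeff hu) fun a ha ρ hρ ↦ by
      rw [norm_mul, Complex.norm_conj, show 2 * (1 : ℝ) * |ρ.re - 1 / 2| * a =
        |ρ.re - 1 / 2| * a + |ρ.re - 1 / 2| * a by ring, Real.exp_add]
      have h0 : 0 ≤ Real.exp (|ρ.re - 1 / 2| * a) := (Real.exp_pos _).le
      nlinarith [(hEb a ha ρ hρ).1, (hEb a ha ρ hρ).2, norm_nonneg (E a ρ),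
        norm_nonneg (E a (1 - conj ρ))]
  rw [NormedAddGroup.tendsto_nhds_zero] at TX TY TE
  obtain ⟨a, ha, hX, hY, hZ⟩ :=
    ((eventually_ge_atTop (0 : ℝ)).and ((TX ε hε).and ((TY ε hε).and (TE δ hδ)))).exists
  -- identify the three sums
  have eX : ∑' ρ : ZetaZeros.riemannZetaNontrivialZeros, (riemannZetaZeroOrder (ρ : ℂ) : ℂ) *
      (weilMellin w ρ * conj (weilMellin (weilTranslate u a + weilTranslate u (-a))
        (1 - conj (ρ : ℂ)))) = ∑' ρ : ZetaZeros.riemannZetaNontrivialZeros,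
      (riemannZetaZeroOrder (ρ : ℂ) : ℂ) * (weilMellin w ρ * conj (weilMellin u (1 - conj (ρ : ℂ))))
        * conj (E a (1 - conj (ρ : ℂ))) := by
    refine tsum_congr fun ρ ↦ ?_
    rw [weilMellin_twoBump hu, map_mul]
    ring
  have eY : ∑' ρ : ZetaZeros.riemannZetaNontrivialZeros, (riemannZetaZeroOrder (ρ : ℂ) : ℂ) *
      (weilMellin (weilTranslate u a + weilTranslate u (-a)) ρ *
        conj (weilMellin w (1 - conj (ρ : ℂ)))) = ∑' ρ : ZetaZeros.riemannZetaNontrivialZeros,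
      (riemannZetaZeroOrder (ρ : ℂ) : ℂ) * (weilMellin u ρ * conj (weilMellin w (1 - conj (ρ : ℂ))))
        * E a ρ := by
    refine tsum_congr fun ρ ↦ ?_
    rw [weilMellin_twoBump hu]
    ring
  have eZ : zeroForm (weilTranslate u a + weilTranslate u (-a)) =
      ∑' ρ : ZetaZeros.riemannZetaNontrivialZeros,
        (riemannZetaZeroOrder (ρ : ℂ) : ℂ) * pairCoeff u ρ *
          (E a ρ * conj (E a (1 - conj (ρ : ℂ)))) := by
    unfold zeroForm
    refine tsum_congr fun ρ ↦ ?_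
    rw [pairCoeff, pairCoeff, weilMellin_twoBump hu, weilMellin_twoBump hu, map_mul]
    ring
  -- unnormalise
  have hn1 : ‖(Real.exp (-(1 / 2 * a)) : ℂ)‖ = Real.exp (-(a / 2)) := by
    rw [Complex.norm_real, Real.norm_eq_abs, abs_of_pos (Real.exp_pos _)]; ring_nf
  have hn2 : ‖(Real.exp (-(1 * a)) : ℂ)‖ = Real.exp (-a) := by
    rw [Complex.norm_real, Real.norm_eq_abs, abs_of_pos (Real.exp_pos _)]; ring_nf
  have hi1 : Real.exp (-(a / 2)) * Real.exp (a / 2) = 1 := by rw [← Real.exp_add]; simp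
  have hi2 : Real.exp (-a) * Real.exp a = 1 := by rw [← Real.exp_add]; simp
  refine ⟨a, ha, ?_, ?_, ?_⟩
  · rw [eX]
    rw [norm_mul, hn1] at hX
    nlinarith [hX, Real.exp_pos (a / 2), norm_nonneg (∑' ρ : ZetaZeros.riemannZetaNontrivialZeros,
      (riemannZetaZeroOrder (ρ : ℂ) : ℂ) * (weilMellin w ρ * conj (weilMellin u (1 - conj (ρ : ℂ))))
        * conj (E a (1 - conj (ρ : ℂ))))]
  · rw [eY]
    rw [norm_mul, hn1] at hY
    nlinarith [hY, Real.exp_pos (a / 2), norm_nonneg (∑' ρ : ZetaZeros.riemannZetaNontrivialZeros,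
      (riemannZetaZeroOrder (ρ : ℂ) : ℂ) * (weilMellin u ρ * conj (weilMellin w (1 - conj (ρ : ℂ))))
        * E a ρ)]
  · rw [eZ]
    rw [norm_mul, hn2] at hZ
    nlinarith [hZ, Real.exp_pos a, norm_nonneg (∑' ρ : ZetaZeros.riemannZetaNontrivialZeros,
        (riemannZetaZeroOrder (ρ : ℂ) : ℂ) * pairCoeff u ρ *
          (E a ρ * conj (E a (1 - conj (ρ : ℂ)))))]

/-! ## The pole form on `span(w, e)` -/

/-- For pole-free `w` (`ŵ(0) = ŵ(1) = 0`) and any test `e`: `P(α w + β e) = |β|² P(e)`.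
[folklore] -/
theorem weilPoleForm_lin_of_poleFree {w e : ℝ → ℂ} (hw : IsWeilTest w) (he : IsWeilTest e)
    (hw0 : weilMellin w 0 = 0) (hw1 : weilMellin w 1 = 0) (α β : ℂ) :
    weilPoleForm (fun t ↦ α * w t + β * e t) = ‖β‖ ^ 2 * weilPoleForm e := by
  have hv := isWeilTest_lin hw he α β
  rw [← two_mul_re_weilMellin_zero_mul_conj_one hv, ← two_mul_re_weilMellin_zero_mul_conj_one he,
    weilMellin_lin hw he, weilMellin_lin hw he, hw0, hw1]
  simp only [mul_zero, zero_add, map_mul]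
  rw [show β * weilMellin e 0 * (conj β * conj (weilMellin e 1)) =
    β * conj β * (weilMellin e 0 * conj (weilMellin e 1)) by ring, re_mul_conj_self_mul]
  ring

/-- The pole form of two far-apart bumps:
`P(u(· − a) + u(· + a)) = 2 (e^{a/2} + e^{-a/2})² û(0) û(1)` when `û(0) = I₀`, `û(1) = I₁` are real.
[folklore] -/
theorem weilPoleForm_twoBump {u : ℝ → ℂ} (hu : IsWeilTest u) {I₀ I₁ : ℝ}
    (hu0 : weilMellin u 0 = I₀) (hu1 : weilMellin u 1 = I₁) (a : ℝ) :
    weilPoleForm (weilTranslate u a + weilTranslate u (-a)) =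
      2 * (Real.exp (a / 2) + Real.exp (-(a / 2))) ^ 2 * I₀ * I₁ := by
  have he : IsWeilTest (weilTranslate u a + weilTranslate u (-a)) :=
    (hu.weilTranslate a).add (hu.weilTranslate (-a))
  rw [← two_mul_re_weilMellin_zero_mul_conj_one he, weilMellin_twoBump hu, weilMellin_twoBump hu,
    (twoExp_zero_one a).1, (twoExp_zero_one a).2, hu0, hu1, map_mul, Complex.conj_ofReal,
    Complex.conj_ofReal]
  push_cast
  simp only [← Complex.ofReal_mul, ← Complex.ofReal_add, Complex.ofReal_re, ← Complex.ofReal_neg,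
    ← Complex.ofReal_exp, ← Complex.ofReal_div, ← Complex.ofReal_ofNat]
  ring

/-- `Re(|α|² Q_w + α β̄ X + ᾱ β Y + |β|² Q_e) ≤ |α|² Re Q_w + |α||β|(|X| + |Y|) + |β|² |Q_e|`.
[folklore] -/
theorem re_polarised_le (α β Qw X Y Qe : ℂ) :
    (α * conj α * Qw + α * conj β * X + conj α * β * Y + β * conj β * Qe).re ≤
      ‖α‖ ^ 2 * Qw.re + ‖α‖ * ‖β‖ * ‖X‖ + ‖α‖ * ‖β‖ * ‖Y‖ + ‖β‖ ^ 2 * ‖Qe‖ := by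
  rw [Complex.add_re, Complex.add_re, Complex.add_re, re_mul_conj_self_mul, re_mul_conj_self_mul]
  have h2 := re_mul_conj_mul_le α β X
  have h3 : (conj α * β * Y).re ≤ ‖α‖ * ‖β‖ * ‖Y‖ := by
    have := re_mul_conj_mul_le β α Y
    rw [mul_comm ‖β‖] at this
    rwa [mul_comm (conj α)]
  have h4 : ‖β‖ ^ 2 * Qe.re ≤ ‖β‖ ^ 2 * ‖Qe‖ :=
    mul_le_mul_of_nonneg_left (Complex.re_le_norm _) (sq_nonneg _)
  linarith

/-- A negative definite binary form: `−q x² + 2 ε x Y − p Y² < 0` off the origin when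
`ε² < q p`. [folklore] -/
theorem binary_neg {q p ε x Y : ℝ} (hq : 0 < q) (hε : ε * ε < q * p) (hx : 0 ≤ x)
    (hY : 0 ≤ Y) (h : x ≠ 0 ∨ Y ≠ 0) : -q * x ^ 2 + 2 * ε * x * Y - p * Y ^ 2 < 0 := by
  rcases eq_or_lt_of_le hY with hY0 | hYpos
  · rcases h with hx0 | hY1
    · have hxpos : 0 < x := lt_of_le_of_ne hx (Ne.symm hx0)
      rw [← hY0]
      nlinarith [mul_pos hq (mul_pos hxpos hxpos)]
    · exact absurd hY0.symm hY1
  · have key : q * (-q * x ^ 2 + 2 * ε * x * Y - p * Y ^ 2) < 0 := by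
      nlinarith [sq_nonneg (q * x - ε * Y), mul_pos (sub_pos.2 hε) (pow_pos hYpos 2)]
    by_contra hc
    push Not at hc
    nlinarith

/-! ## The converse and the equivalence -/

/-- **At most one bound state implies RH.** If among any two test functions some non-trivial
combination `v` has `Q₀(v) ≥ 0`, then the Riemann hypothesis holds: otherwise take a pole-free
`w` with `Re Q(w) = −q < 0` (`riemannHypothesis_iff_poleFree`) and `e_a = u(· − a) + u(· + a)`;
on `span(w, e_a)`, `Q₀(α w + β e_a) ≤ −q|α|² + 2ε|α||β|e^{a/2} + |β|² e^{a}(δ − 2 û(0)û(1)) < 0`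
for `a` large (`exists_far_window`). [cite: Bombieri2000Weil, Thms. 1–2] -/
theorem riemannHypothesis_of_markovIndex_le_one
    (H : ∀ g h : ℝ → ℂ, IsWeilTest g → IsWeilTest h →
      ∃ α β : ℂ, (α ≠ 0 ∨ β ≠ 0) ∧ 0 ≤ weilMarkovQuadratic fun t ↦ α * g t + β * h t) :
    RiemannHypothesis := by
  refine riemannHypothesis_iff_poleFree.2 fun w hw hw0 hw1 ↦ ?_
  by_contra hneg
  push Not at hneg
  obtain ⟨u, hu, I₀, I₁, hI₀, hI₁, hu0, hu1⟩ := exists_isWeilTest_weilMellin_zero_one_pos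
  set q : ℝ := -(weilQuadratic w).re with hq
  have hq0 : 0 < q := by linarith
  have hp : 0 < I₀ * I₁ := mul_pos hI₀ hI₁
  set ε : ℝ := min 1 (q * (I₀ * I₁) / 2) with hε
  have hε0 : 0 < ε := lt_min one_pos (by positivity)
  have hεsq : ε * ε < q * (I₀ * I₁) := by
    nlinarith [min_le_left (1 : ℝ) (q * (I₀ * I₁) / 2), min_le_right (1 : ℝ) (q * (I₀ * I₁) / 2)]
  obtain ⟨a, -, hX, hY, hZ⟩ := exists_far_window hw hu hε0 hp
  set e := weilTranslate u a + weilTranslate u (-a) with he_def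
  have he : IsWeilTest e := (hu.weilTranslate a).add (hu.weilTranslate (-a))
  obtain ⟨α, β, hne, hQ⟩ := H w e hw he
  have hv := isWeilTest_lin hw he α β
  -- the zero side
  have hre : (weilQuadratic fun t ↦ α * w t + β * e t).re ≤
      ‖α‖ ^ 2 * (-q) + ‖α‖ * ‖β‖ * (ε * Real.exp (a / 2)) +
        ‖α‖ * ‖β‖ * (ε * Real.exp (a / 2)) + ‖β‖ ^ 2 * (I₀ * I₁ * Real.exp a) := by
    rw [← combShapeDetection_zeroForm_eq_weilQuadratic hv, zeroForm_lin hw he]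
    refine (re_polarised_le _ _ _ _ _ _).trans ?_
    have h1 : (zeroForm w).re = -q := by
      rw [combShapeDetection_zeroForm_eq_weilQuadratic hw, hq, neg_neg]
    have hαβ : 0 ≤ ‖α‖ * ‖β‖ := by positivity
    rw [h1]
    gcongr
  -- the pole form
  have hP : weilPoleForm (fun t ↦ α * w t + β * e t) =
      ‖β‖ ^ 2 * (2 * (Real.exp (a / 2) + Real.exp (-(a / 2))) ^ 2 * I₀ * I₁) := by
    rw [weilPoleForm_lin_of_poleFree hw he hw0 hw1, he_def, weilPoleForm_twoBump hu hu0 hu1]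
  -- assemble
  have hc : Real.exp a ≤ (Real.exp (a / 2) + Real.exp (-(a / 2))) ^ 2 := exp_le_twoCosh_sq a
  have hea : Real.exp a = Real.exp (a / 2) ^ 2 := by rw [sq, ← Real.exp_add, add_halves]
  have hbin := binary_neg hq0 hεsq (norm_nonneg α)
    (mul_nonneg (norm_nonneg β) (Real.exp_pos (a / 2)).le) (x := ‖α‖) (Y := ‖β‖ * Real.exp (a / 2))
    (by
      rcases hne with hα | hβ
      · exact Or.inl (norm_ne_zero_iff.2 hα)
      · exact Or.inr (mul_ne_zero (norm_ne_zero_iff.2 hβ) (Real.exp_pos _).ne'))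
  have hQ' : weilMarkovQuadratic (fun t ↦ α * w t + β * e t) =
      (weilQuadratic fun t ↦ α * w t + β * e t).re - weilPoleForm (fun t ↦ α * w t + β * e t) := rfl
  rw [hQ', hP] at hQ
  rw [hea] at hre hc
  have hslack := mul_nonneg (mul_nonneg (sq_nonneg ‖β‖) hp.le) (sub_nonneg.2 hc)
  linarith

/-- **RH ⟺ the Markov part of Weil's form has negative index at most one**: the Riemann
hypothesis holds if and only if for all test functions `g, h` some non-trivial combination
`v = α g + β h` satisfies `Q₀(v) ≥ 0`, `Q₀(v) = Re W(v ⋆ ṽ) − 2|∫ v cosh(t/2)|² + 2|∫ v sinh(t/2)|²`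
— i.e. `Q₀` (`= 𝓔_a − M_a‖·‖₂²` on each window, a Markovian jump form minus its killing rate) has
no two-dimensional negative definite subspace. [cite: Bombieri2000Weil, Thms. 1–2] -/
theorem riemannHypothesis_iff_markovIndex_le_one :
    RiemannHypothesis ↔ ∀ g h : ℝ → ℂ, IsWeilTest g → IsWeilTest h →
      ∃ α β : ℂ, (α ≠ 0 ∨ β ≠ 0) ∧ 0 ≤ weilMarkovQuadratic fun t ↦ α * g t + β * h t :=
  ⟨fun h _ _ hg hh ↦ markovIndex_le_one_of_riemannHypothesis h hg hh,
    riemannHypothesis_of_markovIndex_le_one⟩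

/-- **The windowed (bound-state) form**: `RH` holds iff for every `a` and all tests `g, h`
supported in `[-a, a]` some non-trivial combination `v` has `M_a ‖v‖₂² ≤ 𝓔_a(v)` — the
self-adjoint operator of the pure-jump Dirichlet form `𝓔_a` on the window has at most one
eigenvalue below the killing constant `M_a`. [cite: Bombieri2000Weil, Thm. 2 (p. 193)] -/
theorem riemannHypothesis_iff_atMostOneBoundState :
    RiemannHypothesis ↔ ∀ (a : ℝ) (g h : ℝ → ℂ), IsWeilTest g → IsWeilTest h →
      tsupport g ⊆ Icc (-a) a → tsupport h ⊆ Icc (-a) a →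
      ∃ α β : ℂ, (α ≠ 0 ∨ β ≠ 0) ∧
        weilMarkovConstant a * (∫ x : ℝ, ‖α * g x + β * h x‖ ^ 2) ≤
          weilDirichletEnergy a fun t ↦ α * g t + β * h t := by
  have hsupp : ∀ {a : ℝ} {g h : ℝ → ℂ} (α β : ℂ), tsupport g ⊆ Icc (-a) a →
      tsupport h ⊆ Icc (-a) a → tsupport (fun t ↦ α * g t + β * h t) ⊆ Icc (-a) a := by
    intro a g h α β hg hh
    have e : (fun t ↦ α * g t + β * h t) = (fun t ↦ α * g t) + fun t ↦ β * h t := rfl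
    rw [e]
    refine (tsupport_add _ _).trans (union_subset ?_ ?_)
    · exact (tsupport_mul_subset_right (f := fun _ ↦ α) (g := g)).trans hg
    · exact (tsupport_mul_subset_right (f := fun _ ↦ β) (g := h)).trans hh
  constructor
  · intro hRH a g h hg hh hsg hsh
    obtain ⟨α, β, hne, hQ⟩ := markovIndex_le_one_of_riemannHypothesis hRH hg hh
    refine ⟨α, β, hne, ?_⟩
    rw [weilMarkovQuadratic_eq_weilDirichletEnergy_sub (isWeilTest_lin hg hh α β)
      (hsupp α β hsg hsh)] at hQ
    linarith
  · intro H
    refine riemannHypothesis_of_markovIndex_le_one fun g h hg hh ↦ ?_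
    obtain ⟨b, -, hb⟩ := exists_tsupport_subset_Icc hg.2
    obtain ⟨b', -, hb'⟩ := exists_tsupport_subset_Icc hh.2
    have hgb : tsupport g ⊆ Icc (-max b b') (max b b') :=
      hb.trans (Icc_subset_Icc (neg_le_neg (le_max_left _ _)) (le_max_left _ _))
    have hhb : tsupport h ⊆ Icc (-max b b') (max b b') :=
      hb'.trans (Icc_subset_Icc (neg_le_neg (le_max_right _ _)) (le_max_right _ _))
    obtain ⟨α, β, hne, hQ⟩ := H (max b b') g h hg hh hgb hhb
    refine ⟨α, β, hne, ?_⟩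
    rw [weilMarkovQuadratic_eq_weilDirichletEnergy_sub (isWeilTest_lin hg hh α β)
      (hsupp α β hgb hhb)]
    linarith

/-- **Unconditionally `Q₀` has a negative vector** (two far-apart bumps): hence under RH the
negative index of the Markov part is exactly one. [folklore] -/
theorem exists_weilMarkovQuadratic_neg : ∃ g : ℝ → ℂ, IsWeilTest g ∧ weilMarkovQuadratic g < 0 := by
  obtain ⟨u, hu, I₀, I₁, hI₀, hI₁, hu0, hu1⟩ := exists_isWeilTest_weilMellin_zero_one_pos
  obtain ⟨a, -, -, -, hZ⟩ := exists_far_window hu hu one_pos (mul_pos hI₀ hI₁)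
  have he : IsWeilTest (weilTranslate u a + weilTranslate u (-a)) :=
    (hu.weilTranslate a).add (hu.weilTranslate (-a))
  refine ⟨_, he, ?_⟩
  have hQ' : weilMarkovQuadratic (weilTranslate u a + weilTranslate u (-a)) =
      (zeroForm (weilTranslate u a + weilTranslate u (-a))).re -
        2 * (Real.exp (a / 2) + Real.exp (-(a / 2))) ^ 2 * I₀ * I₁ := by
    rw [weilMarkovQuadratic, ← combShapeDetection_zeroForm_eq_weilQuadratic he,
      weilPoleForm_twoBump hu hu0 hu1]
  rw [hQ']
  nlinarith [Complex.re_le_norm (zeroForm (weilTranslate u a + weilTranslate u (-a))),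
    exp_le_twoCosh_sq a, Real.exp_pos a, mul_pos hI₀ hI₁]

end Summit.RiemannHypothesis.RiemannHypothesis.Theorems

end
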